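import Summits.AtomisticToContinuum.BoseEinsteinCondensation.Theses.BECThomsonPrinciple
import Summits.AtomisticToContinuum.BoseEinsteinCondensation.Theses.BECPeriodicReduction
import Summits.AtomisticToContinuum.BoseEinsteinCondensation.Theses.BECWallDressingTransfer
import Literature.MathematicalPhysics.QuantumManyBody.BoseEinsteinCondensation
import Literature.MathematicalPhysics.QuantumManyBody.PeriodicBoseGas

/-!
# Line `Sketch` (crux idea `torus-in-the-box-doob`) for crux `PeriodicToDirichlet`
# (stmt-AtomisticToContinuum-9483) — SKELETON v1b (lead a1, 2026-08-16)

Route `BECThomsonPrinciple`; crux `PeriodicToDirichlet := PeriodicBEC → _root_.BoseEinsteinCondensation`.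

The planner's `TorusInTheBoxSketch.lean` (0 sorries, Props + composition under hypotheses) reshaped
into registered `stub_*` form. The line: put an `A`-exact torus INSIDE the Dirichlet cube, factor the
Dirichlet ground state against the torus ground state by a zero-free Doob factor, and carry one-body
coherence into the INNER cube `(θL, L-θL)³`; close the conjunct linearly in `γ` from the inner flat
mode. Registered stubs (6 ≤ stubs_max = 7; one slot kept for the cycle-2 reshape of `stub_transfer`
into the card's K1 DoobFloor / K2 TiltedTorusLandscape once the Doob vocabulary is typed):

* `stub_innerFlatToBEC : InnerFlatToBEC` — closing glue (provable now; pattern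
  `BECInfraredBound.bec_of_zeroMode`: `occupation_le_maxOccupation` + `le_condensateNumber`).
* `stub_torusLocalCondensation : TorusLocalCondensation` — torus side, where `A` enters (provable
  now: rigid-translation invariance + torus change of variables `lintegral_cellN_comp_equivariant`
  + `‖Σ_{i≤m} G_i‖² ≤ m Σ ‖G_i‖²`).
* `stub_shellMass : ShellMass` — one-body Hardy layer bound `E_Ψ[#shell_b] ≤ (b²/2) ∫ |∇Ψ|²` for
  Dirichlet trial states (provable now: 1-D Hardy `∫₀ᵇ|f|² ≤ (b²/2)∫₀ᵇ|f'|²`, `f(0)=0`, + Fubini).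
* `stub_transfer : TransferToCondensed` — THE TRANSFER (XL, held by the lead): from the two
  provable inputs and `A`, condensed Dirichlet near-minimisers exist at EVERY slack (inner flat mode).
  Inside: Dirichlet ground state (13827-type existence/uniqueness), Doob factorisation against the
  inner torus ground states `Φ''_{N''}` (side `sideLength ρ* N''`, `A` instantiated verbatim), K1
  (Doob floor) and K2 (tilted torus landscape) of the card, estimator identity, sector sums.
* `stub_nearMinimiserTransfer : NearMinimiserTransfer` — provable now (pattern
  `CondensateOccupationStability.le_condensateOccupation_nearMinimiser_of_clustering`, for a general
  bounded compactly supported mode instead of the constant mode): condensed near-minimisers at every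
  slack + `L²`-rigidity of near-minimisers ⇒ ALL `δ`-near-minimisers are inner-flat condensed.
* `stub_rigidity : BECWallDressingTransfer.GroundStateRigidity` — SHARED item
  stmt-AtomisticToContinuum-9072 verbatim (imported decl; pooled, not worked here).

Composition `periodicToDirichlet_of_registered_stubs` concludes the crux BY NAME. v1b: the three
delegated provable stubs (2, 3, 5) carry their signatures UNFOLDED into Literature-only vocabulary, so
that their `--supports` files land kernel-reviewed without waiting for the (review-queued) Defs file
`Theorems/BECThomsonPrinciplePeriodicToDirichletTorusDefs.lean`; they are definitionally the named
Props (checked by the `example`s before the composition).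
-/

noncomputable section

namespace Summit.AtomisticToContinuum.BoseEinsteinCondensation.Cruxes.PeriodicToDirichlet.TorusInTheBox

open Literature.MathematicalPhysics.QuantumManyBody.BoseGas
open _root_.MeasureTheory _root_.Filter
open scoped ENNReal NNReal
open Summit.AtomisticToContinuum.BoseEinsteinCondensation.Theses

/-! ### Torus side -/

/-- Normalised flat mode of the sub-cube of side `L/k` with lower corner `L·j/k` (inside the cell
`[0,L)³`). -/
def subcubeMode (L : ℝ) (k : ℕ) (j : Fin 3 → Fin k) : Space → ℂ :=
  {x : Space | ∀ t, x t - L * (j t : ℕ) / k ∈ Set.Ico 0 (L / k)}.indicator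
    fun _ => ((Real.sqrt ((L / k) ^ 3))⁻¹ : ℂ)

/-- **Torus-side input (provable now).** For every periodic trial state invariant under rigid
translations of all particles (as the unique positive torus ground state is), the constant-mode
occupation is at most `k³` times the flat-mode occupation of ANY sub-cube of side `L/k`:
`n₀ ≤ k³ · n_{flat,C}`, i.e. `n_{flat,C} ≥ (n₀/N) · ρ|C|`. Proof: with
`G_i(Y) = ∫_{C_i} (1_{cell^N}Ψ)(x::Y) dx` over the `k³` translates `C_i` tiling the cell,
`a₀(Ψ)(Y) = L^{-3/2} Σ_i G_i(Y)`, `‖Σ_i G_i(Y)‖² ≤ k³ Σ_i ‖G_i(Y)‖²`, and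
`∫_Y ‖G_i‖² = ∫_Y ‖G_j‖²` for all `i` (Lebesgue translation in `x`, rigid invariance, then the
torus change of variables `lintegral_cellN_comp_equivariant` for the rigid shift of `Y`, using the
periodicity of `Ψ`). -/
def TorusLocalCondensation : Prop :=
  ∀ (N : ℕ) (L : ℝ), 0 < L → ∀ (k : ℕ), 0 < k → ∀ (j : Fin 3 → Fin k)
    (Ψ : PeriodicTrialState N L),
    (∀ (a : Space) (X : Config N), Ψ.ψ (fun i => X i + a) = Ψ.ψ X) →
      condensateOccupation N L Ψ.ψ ≤ (k : ℝ≥0∞) ^ 3 * cellOccupation N L (subcubeMode L k j) Ψ.ψ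

/-! ### Dirichlet side -/

/-- Normalised flat mode of the INNER cube `(θL, L-θL)³` of the Dirichlet box `Λ_L`. -/
def innerFlatMode (θ L : ℝ) : Space → ℂ :=
  {x : Space | ∀ t, x t ∈ Set.Ioo (θ * L) (L - θ * L)}.indicator
    fun _ => ((Real.sqrt (((1 - 2 * θ) * L) ^ 3))⁻¹ : ℂ)

/-- **Dirichlet-side target of the line**: inner-cube flat-mode occupation `≥ cN` for all
`δ`-near-minimisers of the Dirichlet energy along `L_N(ρ)`, some fixed `θ ∈ (0,1/2)`. -/
def InnerFlatOccupation : Prop :=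
  ∀ v : ℝ → ℝ≥0∞, IsRepulsiveFiniteRange v → ∃ ρ₀ : ℝ, 0 < ρ₀ ∧ ∀ ρ : ℝ, 0 < ρ → ρ < ρ₀ →
    ∃ θ : ℝ, 0 < θ ∧ θ < 1 / 2 ∧ ∃ c : ℝ, 0 < c ∧ ∀ᶠ N : ℕ in atTop, ∃ δ : ℝ≥0∞, 0 < δ ∧
      ∀ Ψ : TrialState N (sideLength ρ N),
        energy v Ψ ≤ groundStateEnergy v N (sideLength ρ N) + δ →
          ENNReal.ofReal (c * N) ≤ occupation N (innerFlatMode θ (sideLength ρ N)) Ψ.ψ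

/-- **Closing glue (provable now, as `bec_of_zeroMode`)**: the inner flat mode is a normalised
measurable one-body mode, so its occupation bounds `λ_max` (`occupation_le_maxOccupation`) and a
uniform bound over `δ`-near-minimisers bounds `condensateNumber` (`le_condensateNumber`). -/
def InnerFlatToBEC : Prop :=
  InnerFlatOccupation → _root_.BoseEinsteinCondensation

/-- The boundary layer of depth `b` of the box `Λ_L`: points with some coordinate `< b` or `> L - b`
(strict, so that the two faces of one axis give DISJOINT layers once `2b ≤ L`). -/
def shellLayer (b L : ℝ) : Set Space :=
  {x : Space | ∃ k : Fin 3, x k < b ∨ L - b < x k}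

/-- The number of particles of the configuration `X` in the boundary layer `shellLayer b L`, as an
`ℝ≥0∞`-valued sum of indicators (so that it integrates without coercions). -/
def shellCount (b L : ℝ) {N : ℕ} (X : Config N) : ℝ≥0∞ :=
  ∑ i : Fin N, (shellLayer b L).indicator (fun _ => (1 : ℝ≥0∞)) (X i)

/-- **Shell occupation by the one-body Hardy layer bound (provable now).** For every Dirichlet
trial state `Ψ` of `Λ_L^N` and `0 < b`, `2b ≤ L`: `E_Ψ[#shell_b] = ∫ shellCount·|Ψ|² ≤ (b²/2) ∫ |∇Ψ|²`.
Proof: along each coordinate line `t ↦ Ψ(…, x_{i,k} = t, …)` the function is `C¹` and vanishes at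
`t = 0` and `t = L` (Dirichlet), so `|f(t)|² ≤ t ∫₀ᵗ |f'|²` gives `∫₀ᵇ |f|² ≤ (b²/2) ∫₀ᵇ |f'|²` and
symmetrically at the far face; the two layers of one axis are disjoint (`2b ≤ L`); sum over
`(i,k)` and Fubini: the right side is `(b²/2) ∫ kineticDensity`. -/
def ShellMass : Prop :=
  ∀ (N : ℕ) (L b : ℝ), 0 < b → 2 * b ≤ L → ∀ Ψ : TrialState N L,
    ∫⁻ X, shellCount b L X * (‖Ψ.ψ X‖₊ : ℝ≥0∞) ^ 2 ≤
      ENNReal.ofReal (b ^ 2 / 2) * ∫⁻ X, kineticDensity Ψ.ψ X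

/-- **Condensed near-minimisers at every slack** (the transfer's Dirichlet-side output, ground-state
level, typed WITHOUT ground-state objects): for every admissible `v`, small `ρ`, some `θ ∈ (0,1/2)`
and `c > 0`, for all large `N` and EVERY `ε > 0` there is a Dirichlet trial state within `ε` of
`E₀^D(N, L_N(ρ))` whose inner-cube flat-mode occupation is `≥ cN`. (Equivalent, given compactness
and uniqueness of the Dirichlet ground state, to inner-flat condensation OF the ground state; the
card's estimator identity `n_{flat,C}(Ψ_D)/N = E_{Ψ_D²}[⟨Ψ_D(·,X̂)⟩_C / Ψ_D(x₁,X̂)·1_C(x₁)]` is the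
form in which the Doob factorisation delivers it.) -/
def CondensedNearMinimisers : Prop :=
  ∀ v : ℝ → ℝ≥0∞, IsRepulsiveFiniteRange v → ∃ ρ₀ : ℝ, 0 < ρ₀ ∧ ∀ ρ : ℝ, 0 < ρ → ρ < ρ₀ →
    ∃ θ : ℝ, 0 < θ ∧ θ < 1 / 2 ∧ ∃ c : ℝ, 0 < c ∧ ∀ᶠ N : ℕ in atTop, ∀ ε : ℝ≥0∞, 0 < ε →
      ∃ Φ : TrialState N (sideLength ρ N),
        energy v Φ ≤ groundStateEnergy v N (sideLength ρ N) + ε ∧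
          ENNReal.ofReal (c * N) ≤ occupation N (innerFlatMode θ (sideLength ρ N)) Φ.ψ

/-- **The transfer proper** (what the Doob cruxes K1/K2 + ground-state pair + shell bookkeeping must
deliver): from the torus-side local condensation lemma and the shell bound, the hypothesis
`A = PeriodicBEC` — instantiated verbatim on the inner tori of `N''` particles and side
`sideLength ρ* N''` — yields condensed Dirichlet near-minimisers at every slack. -/
def TransferToCondensed : Prop :=
  TorusLocalCondensation → ShellMass → BECPeriodicReduction.PeriodicBEC → CondensedNearMinimisers

/-- **Near-minimiser transfer (provable now, pure measure theory)**: condensed near-minimisers at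
every slack + mutual `L²`-rigidity of near-minimisers up to phase (stmt-9072) ⇒ every
`δ`-near-minimiser is inner-flat condensed (`√occ` is `N^{1/2}‖φ‖₂`-Lipschitz in `L²` and
phase-invariant; choose `η = c/16`, then `δ` from rigidity, then the condensed competitor at slack `δ`). -/
def NearMinimiserTransfer : Prop :=
  CondensedNearMinimisers → BECWallDressingTransfer.GroundStateRigidity → InnerFlatOccupation

/-! ### Registered stubs -/

/-- **Stub 1** (provable now, S): inner flat-mode occupation of near-minimisers ⇒ the conjunct. -/
theorem stub_innerFlatToBEC : InnerFlatToBEC := by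
  sorry

/-- **Stub 2** (provable now, M): local condensation from global on the torus, for rigidly
translation-invariant periodic states. -/
theorem stub_torusLocalCondensation :
    ∀ (N : ℕ) (L : ℝ), 0 < L → ∀ (k : ℕ), 0 < k → ∀ (j : Fin 3 → Fin k)
      (Ψ : PeriodicTrialState N L),
      (∀ (a : Space) (X : Config N), Ψ.ψ (fun i => X i + a) = Ψ.ψ X) →
        condensateOccupation N L Ψ.ψ ≤ (k : ℝ≥0∞) ^ 3 *
          cellOccupation N L
            (Set.indicator {x : Space | ∀ t, x t - L * (j t : ℕ) / k ∈ Set.Ico 0 (L / k)}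
              (fun _ => ((Real.sqrt ((L / k) ^ 3))⁻¹ : ℂ))) Ψ.ψ := by
  sorry

/-- **Stub 3** (provable now, M): the Hardy layer bound for Dirichlet trial states. -/
theorem stub_shellMass :
    ∀ (N : ℕ) (L b : ℝ), 0 < b → 2 * b ≤ L → ∀ Ψ : TrialState N L,
      ∫⁻ X, (∑ i : Fin N, Set.indicator {x : Space | ∃ k : Fin 3, x k < b ∨ L - b < x k}
          (fun _ => (1 : ℝ≥0∞)) (X i)) * (‖Ψ.ψ X‖₊ : ℝ≥0∞) ^ 2 ≤
        ENNReal.ofReal (b ^ 2 / 2) * ∫⁻ X, kineticDensity Ψ.ψ X := by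
  sorry

/-- **Stub 4** (XL, HARDEST, held by the lead): the Doob transfer. -/
theorem stub_transfer : TransferToCondensed := by
  sorry

/-- **Stub 5** (provable now, M/L): condensed near-minimisers at every slack + rigidity ⇒ all
near-minimisers condensed. -/
theorem stub_nearMinimiserTransfer :
    (∀ v : ℝ → ℝ≥0∞, IsRepulsiveFiniteRange v → ∃ ρ₀ : ℝ, 0 < ρ₀ ∧ ∀ ρ : ℝ, 0 < ρ → ρ < ρ₀ →
      ∃ θ : ℝ, 0 < θ ∧ θ < 1 / 2 ∧ ∃ c : ℝ, 0 < c ∧ ∀ᶠ N : ℕ in atTop, ∀ ε : ℝ≥0∞, 0 < ε →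
        ∃ Φ : TrialState N (sideLength ρ N),
          energy v Φ ≤ groundStateEnergy v N (sideLength ρ N) + ε ∧
            ENNReal.ofReal (c * N) ≤ occupation N
              (Set.indicator {x : Space | ∀ t, x t ∈ Set.Ioo (θ * sideLength ρ N)
                  (sideLength ρ N - θ * sideLength ρ N)}
                (fun _ => ((Real.sqrt (((1 - 2 * θ) * sideLength ρ N) ^ 3))⁻¹ : ℂ))) Φ.ψ) →
    BECWallDressingTransfer.GroundStateRigidity →
    ∀ v : ℝ → ℝ≥0∞, IsRepulsiveFiniteRange v → ∃ ρ₀ : ℝ, 0 < ρ₀ ∧ ∀ ρ : ℝ, 0 < ρ → ρ < ρ₀ →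
      ∃ θ : ℝ, 0 < θ ∧ θ < 1 / 2 ∧ ∃ c : ℝ, 0 < c ∧ ∀ᶠ N : ℕ in atTop, ∃ δ : ℝ≥0∞, 0 < δ ∧
        ∀ Ψ : TrialState N (sideLength ρ N),
          energy v Ψ ≤ groundStateEnergy v N (sideLength ρ N) + δ →
            ENNReal.ofReal (c * N) ≤ occupation N
              (Set.indicator {x : Space | ∀ t, x t ∈ Set.Ioo (θ * sideLength ρ N)
                  (sideLength ρ N - θ * sideLength ρ N)}
                (fun _ => ((Real.sqrt (((1 - 2 * θ) * sideLength ρ N) ^ 3))⁻¹ : ℂ))) Ψ.ψ := by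
  sorry

/-- **Stub 6** (SHARED item stmt-AtomisticToContinuum-9072, verbatim the imported route decl):
`L²`-rigidity of Dirichlet near-minimisers up to phase. -/
theorem stub_rigidity : BECWallDressingTransfer.GroundStateRigidity := by
  sorry

/-- The unfolded stub signatures are definitionally the named statements. -/
example : TorusLocalCondensation := stub_torusLocalCondensation
example : ShellMass := stub_shellMass
example : NearMinimiserTransfer := stub_nearMinimiserTransfer

/-! ### Composition -/

/-- **The crux from the registered stubs (by name).** -/
theorem periodicToDirichlet_of_registered_stubs : BECThomsonPrinciple.PeriodicToDirichlet :=
  fun hA => stub_innerFlatToBEC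
    (stub_nearMinimiserTransfer (stub_transfer stub_torusLocalCondensation stub_shellMass hA)
      stub_rigidity)

/-- Sanity: the crux is literally `PeriodicBEC → conjunct`. -/
example : BECThomsonPrinciple.PeriodicToDirichlet =
    (BECPeriodicReduction.PeriodicBEC → _root_.BoseEinsteinCondensation) := rfl

end Summit.AtomisticToContinuum.BoseEinsteinCondensation.Cruxes.PeriodicToDirichlet.TorusInTheBox

end
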